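import Mathlib
import Literature.Analysis.FluidPDE.LoopCirculation
import HarnessLib

/-!
# Route `TautLoopKelvin`, crux `TautLoopLaw` (stmt-NavierStokesRegularity-15249), line
  `Sketch-ideas-r1k1` (Dini–Saks architecture) — tools stub `stub_tautLoopStepImageLengthTools`

First-order bound for the length of the image of a closed `C¹` loop under a near-identity `C¹`
map. If `Ψ : ℝ³ → ℝ³` is `C¹` with `‖DΨ(γ σ) − (id + h B(γ σ))‖ ≤ ε` along a closed `C¹` loop
`γ`, where `‖B(γ σ)‖ ≤ β`, `0 ≤ h` and `h β ≤ 1`, then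
`len (Ψ ∘ γ) ≤ len γ + h ∫₀¹ ⟪γ′, B(γ) γ′⟫ / ‖γ′‖ + (ε + h² β²) · len γ`
(lengths read as `∫₀¹ ‖·′‖`).

Pure calculus: the chain rule `(Ψ ∘ γ)′ = DΨ(γ) γ′`; the pointwise estimate
`‖v + h T v‖ ≤ ‖v‖ + h ⟪v, T v⟫ / ‖v‖ + h² β² ‖v‖` for `‖T‖ ≤ β`, `0 ≤ h`, `h β ≤ 1`
(square both sides, `‖v + h T v‖² = ‖v‖² + 2 h ⟪v, T v⟫ + h² ‖T v‖²`; the junk value `0 / 0 = 0`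
covers `v = 0`); and monotonicity / linearity of the interval integral. The quotient integrand
`⟪γ′, B γ′⟫ / ‖γ′‖` is measurable and dominated by `β ‖γ′‖`, hence integrable, although it may be
discontinuous at the zeros of `γ′`. Everything is folklore and proved from Mathlib and the loop API
of `Literature.Analysis.FluidPDE.LoopCirculation`.
-/

noncomputable section

open Set Function Real MeasureTheory intervalIntegral Literature.Analysis.FluidPDE
open scoped InnerProductSpace RealInnerProductSpace

namespace Summit.NavierStokesRegularity.NavierStokesRegularity.Theorems

set_option linter.dupNamespace false

local notation3 "E3" => EuclideanSpace ℝ (Fin 3)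

/-! ## The pointwise estimate -/

/-- Elementary real inequality behind the pointwise bound: if `0 ≤ N`, `0 ≤ c`, `-N ≤ a` and
`L² ≤ N² + 2 a N + c N`, then `L ≤ N + a + c` (the right-hand side is nonnegative and its square
dominates `N² + 2 a N + c N` by `(a + c)² + N c ≥ 0`). [folklore] -/
theorem tautLoopImgLen_le_of_sq_le {L N a c : ℝ} (hN : 0 ≤ N) (hc : 0 ≤ c) (ha : -N ≤ a)
    (hsq : L ^ 2 ≤ N ^ 2 + 2 * a * N + c * N) : L ≤ N + a + c := by
  have hR : 0 ≤ N + a + c := by linarith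
  refine le_of_sq_le_sq ?_ hR
  nlinarith [mul_nonneg hN hc, sq_nonneg (a + c)]

/-- **Pointwise bound for a near-identity operator** on a real inner product space: if `‖T‖ ≤ β`,
`0 ≤ h` and `h β ≤ 1`, then `‖v + h T v‖ ≤ ‖v‖ + h ⟪v, T v⟫ / ‖v‖ + h² β² ‖v‖` (at `v = 0` both
sides vanish, with the convention `0 / 0 = 0`). [folklore] -/
theorem tautLoopImgLen_norm_add_smul_le {F : Type*} [NormedAddCommGroup F]
    [InnerProductSpace ℝ F] (T : F →L[ℝ] F) (v : F) {h β : ℝ} (hh : 0 ≤ h) (hT : ‖T‖ ≤ β)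
    (hhβ : h * β ≤ 1) :
    ‖v + h • T v‖ ≤ ‖v‖ + h * (⟪v, T v⟫ / ‖v‖) + h ^ 2 * β ^ 2 * ‖v‖ := by
  by_cases hv : v = 0
  · simp [hv]
  have hN : 0 < ‖v‖ := norm_pos_iff.2 hv
  have hTv : ‖T v‖ ≤ β * ‖v‖ :=
    (T.le_opNorm v).trans (mul_le_mul_of_nonneg_right hT (norm_nonneg v))
  have hinner : |⟪v, T v⟫| ≤ ‖v‖ * (β * ‖v‖) :=
    (abs_real_inner_le_norm v (T v)).trans (mul_le_mul_of_nonneg_left hTv (norm_nonneg v))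
  refine tautLoopImgLen_le_of_sq_le hN.le (by positivity) ?_ ?_
  · -- `-‖v‖ ≤ h ⟪v, T v⟫ / ‖v‖`, from `|⟪v, T v⟫| ≤ β ‖v‖²` and `h β ≤ 1`
    have hi : -(β * ‖v‖) ≤ ⟪v, T v⟫ / ‖v‖ := by
      rw [le_div_iff₀ hN]
      nlinarith [(abs_le.1 hinner).1]
    have h1 : h * (-(β * ‖v‖)) ≤ h * (⟪v, T v⟫ / ‖v‖) := mul_le_mul_of_nonneg_left hi hh
    nlinarith [mul_le_mul_of_nonneg_right hhβ hN.le]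
  · -- `‖v + h T v‖² = ‖v‖² + 2 h ⟪v, T v⟫ + h² ‖T v‖²`
    rw [norm_add_sq_real, real_inner_smul_right, norm_smul, Real.norm_eq_abs, abs_of_nonneg hh]
    have h1 : 2 * (h * (⟪v, T v⟫ / ‖v‖)) * ‖v‖ = 2 * (h * ⟪v, T v⟫) := by
      field_simp
    have h2 : (h * ‖T v‖) ^ 2 ≤ h ^ 2 * β ^ 2 * ‖v‖ * ‖v‖ := by
      have h3 : h * ‖T v‖ ≤ h * (β * ‖v‖) := mul_le_mul_of_nonneg_left hTv hh
      have h4 : 0 ≤ h * ‖T v‖ := mul_nonneg hh (norm_nonneg _)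
      nlinarith [h3, h4]
    rw [h1]
    linarith [h2]

/-! ## Along the loop -/

/-- Chain rule along a `C¹` loop: `(Ψ ∘ γ)′(σ) = DΨ(γ σ) γ′(σ)`. [folklore] -/
theorem tautLoopImgLen_deriv_comp {Ψ : E3 → E3} {γ : ℝ → E3} (hΨ : ContDiff ℝ 1 Ψ)
    (hγ : IsC1Loop γ) (σ : ℝ) :
    deriv (Ψ ∘ γ) σ = fderiv ℝ Ψ (γ σ) (deriv γ σ) :=
  fderiv_comp_deriv σ ((hΨ.differentiable one_ne_zero) _) (hγ.differentiable σ)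

/-- Pointwise bound along the loop: with `‖DΨ(γ σ) − (id + h B(γ σ))‖ ≤ ε`, `‖B(γ σ)‖ ≤ β`,
`0 ≤ h`, `h β ≤ 1`,
`‖(Ψ ∘ γ)′ σ‖ ≤ ‖γ′ σ‖ + h ⟪γ′ σ, B(γ σ) γ′ σ⟫ / ‖γ′ σ‖ + (ε + h² β²) ‖γ′ σ‖`. [folklore] -/
theorem tautLoopImgLen_pointwise {Ψ : E3 → E3} {B : E3 → E3 →L[ℝ] E3} {γ : ℝ → E3}
    {h ε β : ℝ} (hh : 0 ≤ h) (hhβ : h * β ≤ 1) (hΨ : ContDiff ℝ 1 Ψ) (hγ : IsC1Loop γ)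
    (hD : ∀ σ, ‖fderiv ℝ Ψ (γ σ) - (ContinuousLinearMap.id ℝ E3 + h • B (γ σ))‖ ≤ ε)
    (hBβ : ∀ σ, ‖B (γ σ)‖ ≤ β) (σ : ℝ) :
    ‖deriv (Ψ ∘ γ) σ‖ ≤ ‖deriv γ σ‖ + h * (⟪deriv γ σ, B (γ σ) (deriv γ σ)⟫ / ‖deriv γ σ‖)
      + (ε + h ^ 2 * β ^ 2) * ‖deriv γ σ‖ := by
  rw [tautLoopImgLen_deriv_comp hΨ hγ σ]
  set v := deriv γ σ
  set R := fderiv ℝ Ψ (γ σ) - (ContinuousLinearMap.id ℝ E3 + h • B (γ σ)) with hR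
  have hsplit : fderiv ℝ Ψ (γ σ) v = (v + h • B (γ σ) v) + R v := by
    rw [hR]
    simp
  have hrem : ‖R v‖ ≤ ε * ‖v‖ :=
    (R.le_opNorm v).trans (mul_le_mul_of_nonneg_right (hD σ) (norm_nonneg v))
  calc ‖fderiv ℝ Ψ (γ σ) v‖ = ‖(v + h • B (γ σ) v) + R v‖ := by rw [hsplit]
    _ ≤ ‖v + h • B (γ σ) v‖ + ‖R v‖ := norm_add_le _ _
    _ ≤ (‖v‖ + h * (⟪v, B (γ σ) v⟫ / ‖v‖) + h ^ 2 * β ^ 2 * ‖v‖) + ε * ‖v‖ :=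
      add_le_add (tautLoopImgLen_norm_add_smul_le _ v hh (hBβ σ) hhβ) hrem
    _ = _ := by ring

/-- The quotient integrand `⟪γ′, B(γ) γ′⟫ / ‖γ′‖` is dominated by `β ‖γ′‖` when `‖B(γ σ)‖ ≤ β`
(junk value `0` at the zeros of `γ′` included). [folklore] -/
theorem tautLoopImgLen_norm_quot_le {B : E3 → E3 →L[ℝ] E3} {γ : ℝ → E3} {β : ℝ}
    (hBβ : ∀ σ, ‖B (γ σ)‖ ≤ β) (σ : ℝ) :
    ‖⟪deriv γ σ, B (γ σ) (deriv γ σ)⟫ / ‖deriv γ σ‖‖ ≤ β * ‖deriv γ σ‖ := by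
  rw [Real.norm_eq_abs, abs_div, abs_norm]
  by_cases h0 : deriv γ σ = 0
  · simp [h0]
  rw [div_le_iff₀ (norm_pos_iff.2 h0)]
  calc |⟪deriv γ σ, B (γ σ) (deriv γ σ)⟫| ≤ ‖deriv γ σ‖ * ‖B (γ σ) (deriv γ σ)‖ :=
      abs_real_inner_le_norm _ _
    _ ≤ ‖deriv γ σ‖ * (β * ‖deriv γ σ‖) :=
      mul_le_mul_of_nonneg_left (((B (γ σ)).le_opNorm _).trans
        (mul_le_mul_of_nonneg_right (hBβ σ) (norm_nonneg _))) (norm_nonneg _)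
    _ = β * ‖deriv γ σ‖ * ‖deriv γ σ‖ := by ring

/-- The quotient integrand `⟪γ′, B(γ) γ′⟫ / ‖γ′‖` is interval integrable on `[0, 1]` for a `C¹`
loop `γ` and a continuous operator field `B` bounded by `β` along the loop: it is measurable and
dominated by the continuous function `β ‖γ′‖`. [folklore] -/
theorem tautLoopImgLen_intervalIntegrable_quot {B : E3 → E3 →L[ℝ] E3} {γ : ℝ → E3} {β : ℝ}
    (hB : Continuous B) (hγ : IsC1Loop γ) (hBβ : ∀ σ, ‖B (γ σ)‖ ≤ β) :
    IntervalIntegrable (fun σ => ⟪deriv γ σ, B (γ σ) (deriv γ σ)⟫ / ‖deriv γ σ‖) volume 0 1 := by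
  have hγ' : Continuous (deriv γ) := hγ.continuous_deriv
  have hTv : Continuous fun σ => B (γ σ) (deriv γ σ) := (hB.comp hγ.continuous).clm_apply hγ'
  have hmeas : Measurable fun σ => ⟪deriv γ σ, B (γ σ) (deriv γ σ)⟫ / ‖deriv γ σ‖ :=
    (hγ'.inner hTv).measurable.div hγ'.norm.measurable
  exact ((hγ'.norm.intervalIntegrable 0 1).const_mul β).mono_fun' hmeas.aestronglyMeasurable
    (Filter.Eventually.of_forall (tautLoopImgLen_norm_quot_le hBβ))

/-! ## The registered tools stub -/

/-- **Tools stub `stub_tautLoopStepImageLengthTools`** (registered signature, verbatim): the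
first-order length bound for the image of a closed `C¹` loop `γ` under a `C¹` map `Ψ` whose
differential along the loop is `id + h B + O(ε)` with `‖B‖ ≤ β` along the loop, `0 ≤ h`,
`h β ≤ 1`:
`∫₀¹ ‖(Ψ ∘ γ)′‖ ≤ ∫₀¹ ‖γ′‖ + h ∫₀¹ ⟪γ′, B(γ) γ′⟫ / ‖γ′‖ + (ε + h² β²) ∫₀¹ ‖γ′‖`. [folklore] -/
theorem stub_tautLoopStepImageLengthTools : ∀ (Ψ : EuclideanSpace ℝ (Fin 3) → EuclideanSpace ℝ
    (Fin 3)) (B : EuclideanSpace ℝ (Fin 3) → (EuclideanSpace ℝ (Fin 3) →L[ℝ] EuclideanSpace ℝ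
    (Fin 3))) (γ : ℝ → EuclideanSpace ℝ (Fin 3)) (h ε β : ℝ), 0 ≤ h → 0 ≤ ε → 0 ≤ β → h * β ≤ 1 →
    ContDiff ℝ 1 Ψ → Continuous B → Literature.Analysis.FluidPDE.IsC1Loop γ → (∀ σ, ‖fderiv ℝ Ψ
    (γ σ) - (ContinuousLinearMap.id ℝ (EuclideanSpace ℝ (Fin 3)) + h • B (γ σ))‖ ≤ ε) → (∀ σ, ‖B
    (γ σ)‖ ≤ β) → (∫ σ in (0:ℝ)..1, ‖deriv (Ψ ∘ γ) σ‖) ≤ (∫ σ in (0:ℝ)..1, ‖deriv γ σ‖) + h * (∫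
    σ in (0:ℝ)..1, (inner ℝ (deriv γ σ) (B (γ σ) (deriv γ σ))) / ‖deriv γ σ‖) + (ε + h ^ 2 * β ^
    2) * (∫ σ in (0:ℝ)..1, ‖deriv γ σ‖) := by
  intro Ψ B γ h ε β hh _hε _hβ hhβ hΨ hB hγ hD hBβ
  have hf : IntervalIntegrable (fun σ => ‖deriv γ σ‖) volume 0 1 :=
    hγ.continuous_deriv.norm.intervalIntegrable 0 1
  have hq : IntervalIntegrable (fun σ => ⟪deriv γ σ, B (γ σ) (deriv γ σ)⟫ / ‖deriv γ σ‖)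
      volume 0 1 :=
    tautLoopImgLen_intervalIntegrable_quot hB hγ hBβ
  have hL : IntervalIntegrable (fun σ => ‖deriv (Ψ ∘ γ) σ‖) volume 0 1 :=
    ((hΨ.comp hγ.contDiff).continuous_deriv le_rfl).norm.intervalIntegrable 0 1
  have hsum : IntervalIntegrable (fun σ => ‖deriv γ σ‖ + h * (⟪deriv γ σ, B (γ σ) (deriv γ σ)⟫ /
      ‖deriv γ σ‖) + (ε + h ^ 2 * β ^ 2) * ‖deriv γ σ‖) volume 0 1 :=
    (hf.add (hq.const_mul h)).add (hf.const_mul _)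
  calc (∫ σ in (0:ℝ)..1, ‖deriv (Ψ ∘ γ) σ‖)
      ≤ ∫ σ in (0:ℝ)..1, (‖deriv γ σ‖ + h * (⟪deriv γ σ, B (γ σ) (deriv γ σ)⟫ / ‖deriv γ σ‖)
          + (ε + h ^ 2 * β ^ 2) * ‖deriv γ σ‖) :=
        integral_mono_on zero_le_one hL hsum fun σ _ =>
          tautLoopImgLen_pointwise hh hhβ hΨ hγ hD hBβ σ
    _ = (∫ σ in (0:ℝ)..1, ‖deriv γ σ‖)
          + h * (∫ σ in (0:ℝ)..1, ⟪deriv γ σ, B (γ σ) (deriv γ σ)⟫ / ‖deriv γ σ‖)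
          + (ε + h ^ 2 * β ^ 2) * (∫ σ in (0:ℝ)..1, ‖deriv γ σ‖) := by
        rw [integral_add (hf.add (hq.const_mul h)) (hf.const_mul _),
          integral_add hf (hq.const_mul h), intervalIntegral.integral_const_mul,
          intervalIntegral.integral_const_mul]

end Summit.NavierStokesRegularity.NavierStokesRegularity.Theorems

end
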